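import Literature.MathematicalPhysics.QuantumFieldTheory.Balaban1983to89.T4ConvexResponse

/-!
# T⁴ programme, node NE3 (η-rate of the minimisers), route P3 «UNIQUENESS + QUANTITATIVE SECOND VARIATION»
# — the RESTRICTED-SECANT ∕ ERROR-BOUND algebra along a STRAIGHT segment that LEAVES the constraint fibre, and the
# constrained Agmon bound with a DIRECT source bound at the tangent test vector

First generation of the NE3 prover lineage P3 of the cell `pub-balaban` (unit `b2b-balaban-t4-ne3-p3`, technique
«compactness-plus-uniqueness: Lipschitz response of the minimiser from uniqueness + a quantitative second-variation lower
bound (Łojasiewicz∕PL-type inequality) rather than an implicit-function argument»; co-owner #3 of `BINDER-OWNERS.md`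
row NE3 under the ROUND-2 SKELETON-FIRST mandate).  This file is the abstract KERNEL ALGEBRA of §1 (E3) and of the LOCAL
step of the route's skeleton `HOME/t4/skeletons/NE3-t4-ne3-p3.md` (v1 71d0aef383766d71), leaf L13.

THE POINT.  The sibling route P2 (`Support/NE3EnergyPath`, p206756) runs the convexity argument along an ADMISSIBLE path
(inside the constraint fibre), so its left end is a genuine constrained minimum along the path (`φ 0 ≤ φ t`) and
Fermat gives `φ′ 0 ≥ 0`.  Route P3 uses the STRAIGHT exponential segment `t ↦ vary U_A X t` in the ambient gauge
group — no linearising transformation, no implicit-function construction — which LEAVES the fibre for `0 < t < 1`: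
minimality along the path is NOT available.  What IS available (skeleton §1): (E0) Fermat at the UNIQUE constrained
minimiser kills the first variation on tangent directions EXACTLY (row NE3-R2's kernel `fineCritical_avgIter`), and
the segment's direction is tangent UP TO A QUADRATIC defect (the segment returns to the fibre at `t = 1`), so
`|φ′ 0| ≤ κ₀ ℓ²` with `κ₀ = O(b)` small; (E1) at the right end the first variation is the two-spacing residual plus
the same kind of slop, `φ′ 1 ≤ r ℓ + κ₁ ℓ²`; (E2) `φ″ ≥ m ℓ²` (tangent coercivity of the Wilson Hessian along the
segment).  §1 turns (E0)–(E2) into the ERROR BOUND `ℓ ≤ r ∕ (m − κ₀ − κ₁)` — the «RSI ⟹ EB» step of the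
Polyak–Łojasiewicz family ([KNS16] = Karimi–Nutini–Schmidt, App. A: RSI `⟨∇f(x), x − x_p⟩ ≥ μ‖x_p − x‖²` ⟹ EB
`‖∇f(x)‖ ≥ μ‖x_p − x‖`; here with two-sided endpoint slops), together with the action-gap sandwich and the two-data
form.  §2 is the LOCAL counterpart: the constrained Agmon bound of `T4ConstrainedAgmon.agmon_constrained_tangent`
(p185645, route P2's δ-kit) RE-CUT so that the source enters ONLY through ONE number — a bound on the form at the
tangent-corrected Agmon test vector, `B u (w (w u) − c₂) ≤ ρ N(w u) + κ₃ N(w u)²` — instead of a weighted dual bound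
of a source functional on all directions plus a separate cost `|J c₂|`: in route P3 the form is paired with the bare
first variation of the Wilson action at the competitor, which is small ONLY on (almost-)tangent test vectors.  §3
certifies non-vacuity on `ℝ`.

HONEST FRAMING.  Finite-T⁴ ultraviolet bookkeeping (rung (B)+1 of the cell's ladder); [folklore] real analysis and
linear algebra over a bare real vector space; NOTHING is asserted about Bałaban's minimisers, his Hessian, or NE3; no
conditional of the cell (`BetaPertH`, (B), (B^μ)) is used or hidden; NOT infinite volume, NOT a mass gap, NOT Clay,
NOT summit progress.  ABSOLUTE RULE of the cell kept: no printed sentence is a hypothesis of any declaration (the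
context citations name the displays the skeleton's dictionary refers to: [Balaban1985Variational] (26)–(28) p. 282,
(141)–(142) p. 299).  PLACEMENT (human rule 2026-08-19): our lemmas under `Summits/QuantumFields/BalabanUV/`; imports
the accepted `Literature.….T4ConvexResponse` only (its `slope_lower`, `taylor_lower`, `taylor_upper`,
`ConjugationDefect` are used BY NAME); restates nothing of `Support/NE3EnergyPath` (whose `response_along_path` needs
minimality along the path — exactly the hypothesis this route does not have); moves nothing.
-/

set_option autoImplicit false

namespace Summit.QuantumFields.BalabanUV.T4Continuum.NE3SegmentRSI

open Set
open Literature.MathematicalPhysics.QuantumFieldTheory.Balaban1983to89.T4ConvexResponse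
  (slope_lower taylor_lower taylor_upper ConjugationDefect)

noncomputable section

/-! ## §1 Restricted secant ⟹ error bound along a straight segment with two-sided endpoint slops -/

/-- The real-inequality core of «RSI ⟹ EB»: `m ℓ² ≤ r ℓ + κ ℓ²`, `κ < m`, `ℓ, r ≥ 0` ⟹ `ℓ ≤ r ∕ (m − κ)`. [folklore] -/
theorem rsi_errorBound {m κ r ℓ : ℝ} (h : m * ℓ ^ 2 ≤ r * ℓ + κ * ℓ ^ 2) (hκ : κ < m) (hℓ : 0 ≤ ℓ)
    (hr : 0 ≤ r) : ℓ ≤ r / (m - κ) := by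
  have hmk : 0 < m - κ := by linarith
  rcases hℓ.eq_or_lt with hz | hpos
  · rw [← hz]; positivity
  · rw [le_div_iff₀ hmk]
    have h1 : (m - κ) * ℓ * ℓ ≤ r * ℓ := by nlinarith
    have := le_of_mul_le_mul_right h1 hpos
    linarith

/-- **ERROR BOUND ALONG A STRAIGHT SEGMENT (RSI ⟹ EB with endpoint slops).**  Let `φ` be the action along the
straight segment from the constrained minimiser (`t = 0`) to the competitor (`t = 1`), `ℓ ≥ 0` the energy length of
the segment.  If `φ″ ≥ m ℓ²` on `[0,1]` (tangent coercivity along the segment), the left end is critical up to a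
quadratic constraint slop, `−κ₀ ℓ² ≤ φ′ 0`, and the right end carries the residual plus slop, `φ′ 1 ≤ r ℓ + κ₁ ℓ²`,
with `κ₀ + κ₁ < m`, then `ℓ ≤ r ∕ (m − κ₀ − κ₁)`.  NO minimality along the segment is assumed (the segment may leave
the constraint fibre).  Dictionary (skeleton §1): `ℓ = N_{U_A}(X)`, `m = c_T − C″ε₂`, `κ₀, κ₁ = O(b)`, `r = C_P3·r_k`.
[folklore] [cite: Balaban1985Variational, (141)–(142) p. 299 (context: at the minimiser the first variation vanishes
on tangent directions and the expansion has no linear term)] -/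
theorem response_along_segment {φ' φ'' : ℝ → ℝ} {m κ₀ κ₁ r ℓ : ℝ}
    (h2 : ∀ t ∈ Icc (0:ℝ) 1, HasDerivAt φ' (φ'' t) t)
    (hconv : ∀ t ∈ Icc (0:ℝ) 1, m * ℓ ^ 2 ≤ φ'' t)
    (hleft : -(κ₀ * ℓ ^ 2) ≤ φ' 0) (hright : φ' 1 ≤ r * ℓ + κ₁ * ℓ ^ 2)
    (hm : κ₀ + κ₁ < m) (hℓ : 0 ≤ ℓ) (hr : 0 ≤ r) : ℓ ≤ r / (m - (κ₀ + κ₁)) := by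
  have h0 : (0:ℝ) ∈ Icc (0:ℝ) 1 := by simp
  have h1 : (1:ℝ) ∈ Icc (0:ℝ) 1 := by simp
  have key := slope_lower h2 hconv h0 h1 zero_le_one
  -- key : m * ℓ ^ 2 * (1 - 0) ≤ φ' 1 - φ' 0
  refine rsi_errorBound (κ := κ₀ + κ₁) ?_ hm hℓ hr
  nlinarith

/-- The same with the competitor's end stated as an absolute value (the form used when the right end is the SUM of a
residual pairing and a slop of either sign). [folklore] -/
theorem response_along_segment_abs {φ' φ'' : ℝ → ℝ} {m κ₀ κ₁ r ℓ : ℝ}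
    (h2 : ∀ t ∈ Icc (0:ℝ) 1, HasDerivAt φ' (φ'' t) t)
    (hconv : ∀ t ∈ Icc (0:ℝ) 1, m * ℓ ^ 2 ≤ φ'' t)
    (hleft : |φ' 0| ≤ κ₀ * ℓ ^ 2) (hright : |φ' 1| ≤ r * ℓ + κ₁ * ℓ ^ 2)
    (hm : κ₀ + κ₁ < m) (hℓ : 0 ≤ ℓ) (hr : 0 ≤ r) : ℓ ≤ r / (m - (κ₀ + κ₁)) :=
  response_along_segment h2 hconv (by linarith [neg_abs_le (φ' 0)]) ((le_abs_self _).trans hright) hm hℓ hr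

/-- **ACTION GAP ALONG THE SEGMENT** (both halves, no minimality along the segment): with `φ″ ≥ m ℓ²` on `[0,1]`,
`−κ₀ℓ² ≤ φ′ 0` and `φ′ 1 ≤ r ℓ + κ₁ ℓ²`:  `(m∕2 − κ₀) ℓ² ≤ φ 1 − φ 0 ≤ r ℓ + (κ₁ − m∕2) ℓ²` — the competitor's
action exceeds the minimum by an amount quadratic in the energy distance (the action reading of NE3 carries the rate
SQUARED; cross-check of row NE3's `MinimalActionRate.actionRate_sfClass`). [folklore] -/
theorem actionGap_along_segment {φ φ' φ'' : ℝ → ℝ} {m κ₀ κ₁ r ℓ : ℝ}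
    (h1 : ∀ t ∈ Icc (0:ℝ) 1, HasDerivAt φ (φ' t) t) (h2 : ∀ t ∈ Icc (0:ℝ) 1, HasDerivAt φ' (φ'' t) t)
    (hconv : ∀ t ∈ Icc (0:ℝ) 1, m * ℓ ^ 2 ≤ φ'' t)
    (hleft : -(κ₀ * ℓ ^ 2) ≤ φ' 0) (hright : φ' 1 ≤ r * ℓ + κ₁ * ℓ ^ 2) :
    (m / 2 - κ₀) * ℓ ^ 2 ≤ φ 1 - φ 0 ∧ φ 1 - φ 0 ≤ r * ℓ + (κ₁ - m / 2) * ℓ ^ 2 := by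
  have lo := taylor_lower h1 h2 hconv
  have up := taylor_upper h1 h2 hconv
  constructor
  · linarith
  · linarith

/-- With the error bound plugged in, the action gap is at most `r²∕(m − κ₀ − κ₁) · (1 + κ₁∕(m − κ₀ − κ₁))`-type; we
record the clean consequence `φ 1 − φ 0 ≤ r ℓ + κ₁ ℓ²` ⟹ `≤ (r + κ₁ ℓ) ℓ` and `ℓ ≤ r∕(m−κ)` ⟹
`φ 1 − φ 0 ≤ (1 + κ₁∕(m−κ)) · r² ∕ (m − κ)` (`κ = κ₀ + κ₁`). [folklore] -/
theorem actionGap_le_of_errorBound {gap r ℓ m κ κ₁ : ℝ} (hgap : gap ≤ r * ℓ + κ₁ * ℓ ^ 2)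
    (hℓ : ℓ ≤ r / (m - κ)) (hℓ0 : 0 ≤ ℓ) (hr : 0 ≤ r) (hκ₁ : 0 ≤ κ₁) (hmk : 0 < m - κ) :
    gap ≤ (1 + κ₁ / (m - κ)) * (r ^ 2 / (m - κ)) := by
  have hA : r * ℓ ≤ r * (r / (m - κ)) := mul_le_mul_of_nonneg_left hℓ hr
  have hB : κ₁ * ℓ ^ 2 ≤ κ₁ * (r / (m - κ)) ^ 2 := by
    apply mul_le_mul_of_nonneg_left _ hκ₁
    exact pow_le_pow_left₀ hℓ0 hℓ 2
  have hr2 : r * (r / (m - κ)) = r ^ 2 / (m - κ) := by ring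
  have hsq : κ₁ * (r / (m - κ)) ^ 2 = κ₁ / (m - κ) * (r ^ 2 / (m - κ)) := by
    field_simp
  calc gap ≤ r * ℓ + κ₁ * ℓ ^ 2 := hgap
    _ ≤ r * (r / (m - κ)) + κ₁ * (r / (m - κ)) ^ 2 := add_le_add hA hB
    _ = (1 + κ₁ / (m - κ)) * (r ^ 2 / (m - κ)) := by rw [hr2, hsq]; ring

/-- **TWO-DATA FORM ALONG THE SEGMENT** («Lipschitz response of the minimiser in the constraint∕background data»,
skeleton ROOT T-LIP-P3): along the straight segment between the minimisers of the SAME action on two nearby fibres,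
BOTH ends are critical on their own tangent spaces; the datum difference enters only through the non-tangential
component of the direction, producing first-order endpoint terms `r₀ ℓ`, `r₁ ℓ` (plus quadratic slops).  Then
`ℓ ≤ (r₀ + r₁) ∕ (m − κ₀ − κ₁)`. [folklore] -/
theorem twoData_along_segment {φ' φ'' : ℝ → ℝ} {m κ₀ κ₁ r₀ r₁ ℓ : ℝ}
    (h2 : ∀ t ∈ Icc (0:ℝ) 1, HasDerivAt φ' (φ'' t) t)
    (hconv : ∀ t ∈ Icc (0:ℝ) 1, m * ℓ ^ 2 ≤ φ'' t)
    (hleft : -(r₀ * ℓ + κ₀ * ℓ ^ 2) ≤ φ' 0) (hright : φ' 1 ≤ r₁ * ℓ + κ₁ * ℓ ^ 2)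
    (hm : κ₀ + κ₁ < m) (hℓ : 0 ≤ ℓ) (hr₀ : 0 ≤ r₀) (hr₁ : 0 ≤ r₁) :
    ℓ ≤ (r₀ + r₁) / (m - (κ₀ + κ₁)) := by
  have h0 : (0:ℝ) ∈ Icc (0:ℝ) 1 := by simp
  have h1 : (1:ℝ) ∈ Icc (0:ℝ) 1 := by simp
  have key := slope_lower h2 hconv h0 h1 zero_le_one
  refine rsi_errorBound (κ := κ₀ + κ₁) ?_ hm hℓ (by linarith)
  nlinarith

/-- The modulus bookkeeping of (E2)–(E3): if the tangent coercivity constant is `c`, the continuity∕projection losses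
along the segment are `C·ε₂ ≤ c∕4` and the endpoint slops are `κ₀ + κ₁ ≤ c∕4`, then the effective denominator is at
least `c∕2`, so `ℓ ≤ 2 r ∕ c`. [folklore] -/
theorem errorBound_half {c Cε κ₀ κ₁ r ℓ : ℝ} (hc : 0 < c) (hr : 0 ≤ r) (hCε : Cε ≤ c / 4) (hκ : κ₀ + κ₁ ≤ c / 4)
    (hℓ : ℓ ≤ r / ((c - Cε) - (κ₀ + κ₁))) : ℓ ≤ 2 * r / c := by
  have hden : c / 2 ≤ (c - Cε) - (κ₀ + κ₁) := by linarith
  have hpos : 0 < (c - Cε) - (κ₀ + κ₁) := by linarith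
  calc ℓ ≤ r / ((c - Cε) - (κ₀ + κ₁)) := hℓ
    _ ≤ r / (c / 2) := div_le_div_of_nonneg_left hr (by positivity) hden
    _ = 2 * r / c := by field_simp

/-! ## §2 The constrained Agmon bound with a DIRECT source bound at the tangent test vector -/

section Agmon

variable {E : Type*} [AddCommGroup E] [Module ℝ E]

/-- **CONSTRAINED AGMON BOUND, SOURCE READ AT THE TEST VECTOR ONLY.**  `B` is m-coercive w.r.t. the gauge `N` on
the subspace `T` and Λ-continuous everywhere, `N` non-negative and subadditive; the conjugated field `w u` is
corrected into `T` (`w u − c₁ ∈ T`, `N c₁ ≤ θ₁ N(w u)`), the Agmon test field `w (w u)` is corrected into `T`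
(`w (w u) − c₂ ∈ T`) at form cost `|B u c₂| ≤ κ₂ N(w u)²`; the conjugation defect of `w` is `κ`; and — the ONLY
place the source enters — the form at the corrected test vector is bounded DIRECTLY:
`B u (w (w u) − c₂) ≤ ρ N(w u) + κ₃ N(w u)²`.  Then `N(w u) ≤ ρ ∕ (m(1−θ₁)² − Λθ₁(2+θ₁) − κ − κ₂ − κ₃)`.
Compared with `T4ConstrainedAgmon.agmon_constrained_tangent` (p185645) the hypotheses `hweak`, `hJ`
(`WeightedDualBound` on ALL directions) and `hJc₂` are replaced by the single `hsrc`: in route P3 the form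
`B = ∫₀¹ hess(γ_t) dt` along the straight segment is paired with the bare first variation of the Wilson action at the
competitor, which is small only on (almost-)tangent test vectors (skeleton §1 LOCAL, (E1)).  Algebra only.
[folklore] [cite: Balaban1985Variational, (26)–(28) p. 282 (context: the first variation ⟨A, J⟩ and the Hessian
⟨A, ΔA⟩ of the Wilson action this is meant for)] -/
theorem agmon_segment (B : E →ₗ[ℝ] E →ₗ[ℝ] ℝ) (w : E →ₗ[ℝ] E) (T : Submodule ℝ E) (N : E → ℝ)
    {m Λ κ κ₂ κ₃ θ₁ ρ : ℝ}
    (hm : κ + κ₂ + κ₃ + Λ * θ₁ * (2 + θ₁) < m * (1 - θ₁) ^ 2) (hm₀ : 0 ≤ m) (hΛ : 0 ≤ Λ)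
    (hθ₁ : 0 ≤ θ₁) (hθ₁' : θ₁ ≤ 1) (hρ : 0 ≤ ρ)
    (hcoerT : ∀ v ∈ T, m * N v ^ 2 ≤ B v v) (hcont : ∀ v h, |B v h| ≤ Λ * N v * N h)
    (hNsub : ∀ a b, N a ≤ N (a - b) + N b) (hNnn : ∀ v, 0 ≤ N v)
    (hAg : ConjugationDefect B w N κ) {u c₁ c₂ : E}
    (hc₁T : w u - c₁ ∈ T) (hc₁ : N c₁ ≤ θ₁ * N (w u))
    (hBc₂ : |B u c₂| ≤ κ₂ * N (w u) ^ 2)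
    (hsrc : B u (w (w u) - c₂) ≤ ρ * N (w u) + κ₃ * N (w u) ^ 2) :
    N (w u) ≤ ρ / (m * (1 - θ₁) ^ 2 - Λ * θ₁ * (2 + θ₁) - κ - κ₂ - κ₃) := by
  set X := N (w u) with hX
  have hX0 : 0 ≤ X := hNnn _
  have hD : 0 < m * (1 - θ₁) ^ 2 - Λ * θ₁ * (2 + θ₁) - κ - κ₂ - κ₃ := by linarith
  -- coercivity at the corrected conjugated field
  have hco := hcoerT _ hc₁T
  have hlow : (1 - θ₁) * X ≤ N (w u - c₁) := by
    have := hNsub (w u) c₁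
    nlinarith
  have hlow2 : m * ((1 - θ₁) * X) ^ 2 ≤ m * N (w u - c₁) ^ 2 := by
    have h0 : 0 ≤ (1 - θ₁) * X := mul_nonneg (by linarith) hX0
    exact mul_le_mul_of_nonneg_left (pow_le_pow_left₀ h0 hlow 2) hm₀
  -- expand B at w u - c₁
  have hexp : B (w u - c₁) (w u - c₁) = B (w u) (w u) - B (w u) c₁ - B c₁ (w u) + B c₁ c₁ := by
    simp only [map_sub, LinearMap.sub_apply]; ring
  have e1 : -B (w u) c₁ ≤ Λ * X * (θ₁ * X) := by
    have h := hcont (w u) c₁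
    have h' := (neg_le_abs _).trans h
    have : Λ * N (w u) * N c₁ ≤ Λ * X * (θ₁ * X) :=
      mul_le_mul_of_nonneg_left hc₁ (mul_nonneg hΛ hX0)
    linarith
  have e2 : -B c₁ (w u) ≤ Λ * (θ₁ * X) * X := by
    have h := hcont c₁ (w u)
    have h' := (neg_le_abs _).trans h
    have : Λ * N c₁ * N (w u) ≤ Λ * (θ₁ * X) * X := by
      have := mul_le_mul_of_nonneg_left hc₁ hΛ
      exact mul_le_mul_of_nonneg_right this hX0
    linarith
  have e3 : B c₁ c₁ ≤ Λ * (θ₁ * X) * (θ₁ * X) := by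
    have h := hcont c₁ c₁
    have h' := (le_abs_self _).trans h
    have hc0 : 0 ≤ N c₁ := hNnn _
    have : Λ * N c₁ * N c₁ ≤ Λ * (θ₁ * X) * (θ₁ * X) := by
      have a1 : Λ * N c₁ ≤ Λ * (θ₁ * X) := mul_le_mul_of_nonneg_left hc₁ hΛ
      calc Λ * N c₁ * N c₁ ≤ Λ * (θ₁ * X) * N c₁ := mul_le_mul_of_nonneg_right a1 hc0
        _ ≤ Λ * (θ₁ * X) * (θ₁ * X) :=
          mul_le_mul_of_nonneg_left hc₁ (mul_nonneg hΛ (mul_nonneg hθ₁ hX0))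
    linarith
  -- conjugation defect and the direct source bound at the corrected test vector
  have hA := hAg u
  have hsplit : B u (w (w u)) = B u (w (w u) - c₂) + B u c₂ := by
    rw [map_sub]; ring
  have e6 : B u c₂ ≤ κ₂ * X ^ 2 := (le_abs_self _).trans hBc₂
  have hmain : (m * (1 - θ₁) ^ 2 - Λ * θ₁ * (2 + θ₁) - κ - κ₂ - κ₃) * X ^ 2 ≤ ρ * X := by
    rw [hsplit] at hA
    nlinarith
  rw [le_div_iff₀ hD]
  rcases eq_or_lt_of_le hX0 with h0 | hpos
  · rw [← h0]; simp; exact hρ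
  · nlinarith

end Agmon

/-! ## §3 Non-vacuity on `ℝ` -/

namespace Witness

/-- On `ℝ`, `φ t = (t ℓ)²` along the segment from `0` to `ℓ`: `φ′ t = 2 ℓ² t`, `φ″ = 2 ℓ²` (`m = 2`), `φ′ 0 = 0`
(`κ₀ = 0`), `φ′ 1 = 2ℓ·ℓ` (`r = 2ℓ`, `κ₁ = 0`): the error bound returns `ℓ ≤ 2ℓ∕2`. [folklore] -/
theorem response_segment_witness (ℓ : ℝ) (hℓ : 0 ≤ ℓ) : ℓ ≤ (2 * ℓ) / (2 - (0 + 0)) := by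
  have h := response_along_segment (φ' := fun t => 2 * ℓ ^ 2 * t) (φ'' := fun _ => 2 * ℓ ^ 2)
    (m := 2) (κ₀ := 0) (κ₁ := 0) (r := 2 * ℓ) (ℓ := ℓ)
    (fun t _ => by simpa using (hasDerivAt_id' t).const_mul (2 * ℓ ^ 2))
    (fun t _ => by simp) (by simp) (by simp; nlinarith) (by norm_num) hℓ (by positivity)
  exact h

/-- The real-inequality core on numbers: `m = 1`, `κ = 1∕2`, `r = 1`, `ℓ = 2` satisfies `m ℓ² ≤ r ℓ + κ ℓ²`
(4 ≤ 2 + 2) and the conclusion `2 ≤ 1∕(1 − 1∕2)`. [folklore] -/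
theorem rsi_witness : (2:ℝ) ≤ 1 / (1 - 1 / 2) :=
  rsi_errorBound (m := 1) (κ := 1/2) (r := 1) (ℓ := 2) (by norm_num) (by norm_num) (by norm_num) (by norm_num)

end Witness

end

end Summit.QuantumFields.BalabanUV.T4Continuum.NE3SegmentRSI
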